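import Mathlib
import HarnessLib
import Summits.Ventures.LatticeQCDFlow.Scoring.IMHAcceptanceRecordJumpReweighting
import Summits.Ventures.LatticeQCDFlow.Scoring.MarkovChainSLLN

/-!
# The IMH acceptance record XIII: the sojourn-reweighted estimator is asymptotically normal —
# strong consistency, the ratio CLT from any start, and its variance in closed form

HONEST FRAMING: exact (Metropolis-corrected) sampling algorithms for lattice gauge theory; figures
of merit are autocorrelation/cost numbers at stated couplings and volumes; no continuum-physics
claim.  This file is value-free (no number of ours appears) and nothing in it is cited as a fact.

Venture `LatticeQCDFlow` (cell pub-lqcd), topic `Scoring`; flow / samplers seat (GEN-48).  NEW WORK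
(tree-internal).  XII (`…JumpReweighting`) introduced the SOJOURN-REWEIGHTED ESTIMATOR
`R_N = Σ_{i<N} g(Y_i)/α(Y_i) / Σ_{i<N} 1/α(Y_i)` of a target mean `πg`, built from the accepted
configurations `Y_0, Y_1, …` of the flow-MCMC kernel `K = indepMH q w` alone (the `J̃ = imhJump q w`
chain of VII; any initial law `μ₀`, path law `P̃_{μ₀}` = Mathlib's `Kernel.trajMeasure`), with
finite-`N` tails through a PATHWISE domination, and listed as NOT CLAIMED "a CLT or asymptotic
variance for the ratio `R_N`".  This file takes the Slutsky step.  Throughout `π = w · q` is a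
probability law, `α ≥ m > 0` a floor, `ā = ∫ α dπ`, `π̃ = α π/ā` the tilt, `|g| ≤ C` measurable,
`ḡ = g − πg`, `u = ḡ/α`, `D_N = (1/N) Σ_{i<N} 1/α(Y_i)` (mean EXPECTED multiplicity).
* §1 **SLUTSKY FORM** (`JumpRatio.sqrt_mul_ratio_sub_eq`, deterministic): for weights
  `0 < a_i ≤ 1` and EVERY `N`, `√N (R_N − c) = ((√N)⁻¹ Σ_{i<N} (g_i − c)/a_i) / max(D_N, 1)`
  (`D_N ≥ 1`; both sides vanish at `N = 0`); and `∫ 1/α dπ̃ = 1/ā` (`JumpRatio.integral_tilt_inv`).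
* §2 **STRONG LAWS ON THE ACCEPTED STREAM, ANY START** (the tree's `markovChain_slln` at
  `κ = J̃`, `ε = ā/2`): `(1/N) Σ_{i<N} f(Y_i) → π̃ f` a.s. for bounded measurable `f`
  (`jumpChain_slln`); the PROPOSAL CLOCK `D_N → 1/ā` a.s. (`meanInvAccept_tendsto_ae`: `N`
  acceptances cost `N D_N ∼ N/ā` proposals); STRONG CONSISTENCY `R_N → πg` a.s.
  (`reweighted_tendsto_ae`, through XII's domination `|R_N − πg| ≤ |(1/N) Σ u(Y_i)|`).
* §3 **THE VARIANCE IN CLOSED FORM** (`reweighted_asympVar_eq`, from VIII's shared Poisson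
  solution `h − K h = ḡ`, `h − J̃ h = u`): `ā² σ²_J̃(u) = V := ā (σ²_K(ḡ) − ∫ ḡ² (1/α − 1) dπ)`,
  `σ²_J̃(u) = ∫ u² dπ̃ + 2 Σ_{k≥1} ∫ u J̃^k u dπ̃`, `σ²_K(ḡ) = ∫ ḡ² dπ + 2 Σ_{k≥1} ∫ ḡ K^k ḡ dπ` the
  Green–Kubo variances (the constants of the tree's `markovChain_clt` at `κ = J̃`, resp. at `κ = K`
  for the PLAIN time average); `V ≤ ā σ²_K(ḡ)` (`reweighted_asympVar_le`).  **THE RATIO CLT, ANY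
  START** (`reweighted_clt`): `√N (R_N − πg) ⇒ N(0, V)` under `P̃_{μ₀}` — XII's `jumpChain_clt`
  for `(√N)⁻¹ Σ u(Y_i)` rescaled by `ā`, §2 for the denominator, Mathlib's Slutsky lemma with the
  continuous map `(s, d) ↦ s / max(d, 1)`, and §1 on every path.
* §4 `flowSampler_jump_ratio_clt`: the exact flow sampler on `SU(n)^E` under the hypotheses of
  `Exactness.flowSampler_exact_doeblin` (uniform Lüscher defect `δ`, every volume; `m = e^{−2δ}`).

Reading (value-free): per ACCEPTED configuration the reweighted estimator has asymptotic variance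
`V`; `N` acceptances consume `∼ N/ā` proposals (§2), so per PROPOSAL (action / flow evaluation)
its constant is `V/ā = σ²_K(ḡ) − ∫ ḡ²(1/α − 1) dπ ≤ σ²_K(ḡ)`, the plain time average's: replacing
realised sojourns by their expectations `1/α` removes the geometric sojourn noise (VIII
`asympVar_indepMH_eq_jump` read from the other side).  Printed counterparts NAMED ONLY (not used,
not matched in form): Rao–Blackwellised MH multiplicities, Douc–Robert 2011
[galaxy:pdf:-7173847574603489160 p.2]; jump-chain / importance-weight forms of MH estimators and
their CLTs [corpus:paper:arxiv-1606.08373 p.5 Thm 1], [corpus:paper:arxiv-1910.13316 p.4 §3],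
[corpus:paper:arxiv-1609.02541 p.12].  NOT CLAIMED: any number of ours (no `δ`, `ā`, `m`, `α`, `V`
of a concrete flow or coupling); a studentised CLT / confidence interval with ESTIMATED `V`; the
estimated-`α` estimator; unbounded `g` or no floor; a CLT in PROPOSAL time (only the a.s. clock
`D_N → 1/ā` is proved); optimality of the weights `1/α`; anything deciding between samplers.
-/

noncomputable section

namespace Summit.Ventures.LatticeQCDFlow.Scoring

open MeasureTheory ProbabilityTheory Filter Finset Summit.Ventures.LatticeQCDFlow.Exactness
open scoped ENNReal Topology

variable {Ω : Type*} [MeasurableSpace Ω]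

/-! ### §1 The self-normalised statistic in Slutsky form (deterministic) -/

/-- **SLUTSKY FORM OF THE SELF-NORMALISED ERROR.**  For weights `0 < a_i ≤ 1`, values `g_i`, a
constant `c` and EVERY `N` (both sides vanish at `N = 0`):
`√N (Σ_{i<N} g_i/a_i / Σ_{i<N} 1/a_i − c) = ((√N)⁻¹ Σ_{i<N} (g_i − c)/a_i) / max(D_N, 1)`,
`D_N = (Σ_{i<N} 1/a_i)/N ≥ 1`. -/
theorem JumpRatio.sqrt_mul_ratio_sub_eq {a g : ℕ → ℝ} (ha0 : ∀ i, 0 < a i) (ha1 : ∀ i, a i ≤ 1)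
    (c : ℝ) (N : ℕ) :
    Real.sqrt N * ((∑ i ∈ Finset.range N, g i / a i) / (∑ i ∈ Finset.range N, 1 / a i) - c)
      = ((Real.sqrt N)⁻¹ * ∑ i ∈ Finset.range N, (g i - c) / a i)
          / max ((∑ i ∈ Finset.range N, 1 / a i) / N) 1 := by
  rcases Nat.eq_zero_or_pos N with rfl | hN
  · simp
  have hNr : (0 : ℝ) < N := Nat.cast_pos.2 hN
  have hD1 : (N : ℝ) ≤ ∑ i ∈ Finset.range N, 1 / a i := by
    calc (N : ℝ) = ∑ i ∈ Finset.range N, (1 : ℝ) := by simp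
      _ ≤ _ := Finset.sum_le_sum fun i _ => by rw [le_div_iff₀ (ha0 i), one_mul]; exact ha1 i
  have hD : 0 < ∑ i ∈ Finset.range N, 1 / a i := hNr.trans_le hD1
  have hnum : (∑ i ∈ Finset.range N, g i / a i) / (∑ i ∈ Finset.range N, 1 / a i) - c
      = (∑ i ∈ Finset.range N, (g i - c) / a i) / ∑ i ∈ Finset.range N, 1 / a i := by
    rw [eq_div_iff hD.ne', sub_mul, div_mul_cancel₀ _ hD.ne', Finset.mul_sum,
      ← Finset.sum_sub_distrib]
    exact Finset.sum_congr rfl fun i _ => by rw [sub_div, mul_one_div]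
  rw [max_eq_left ((one_le_div hNr).2 hD1), hnum, div_div_eq_mul_div, mul_right_comm,
    inv_mul_eq_div, Real.div_sqrt, mul_div_assoc]

variable {q : Measure Ω} [IsProbabilityMeasure q] {w : Ω → ℝ} {π : Measure Ω}

/-- **The accepted rows see the harmonic acceptance**: `∫ 1/α dπ̃ = 1/ā` (VIII). -/
theorem JumpRatio.integral_tilt_inv (hw : Measurable w) (hw0 : ∀ x, 0 < w x)
    [IsProbabilityMeasure π] :
    ∫ x, 1 / (imhAcceptMass q w x).toReal ∂(imhTilt q w π)
      = ((∫⁻ x, imhAcceptMass q w x ∂π).toReal)⁻¹ := by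
  simpa [integral_const, probReal_univ] using
    JumpVar.integral_tilt_div (q := q) hw hw0 π fun _ => (1 : ℝ)

/-! ### §2 Strong laws on the accepted stream, from any start -/

section Path

variable [IsMarkovKernel (imhJump q w)] {μ₀ : Measure Ω} [IsProbabilityMeasure μ₀]

/-- **THE STRONG LAW FOR ACCEPTED-STREAM AVERAGES, ANY START** (`π = w q` a probability law,
`|f| ≤ C` measurable): `P̃_{μ₀}`-a.s. `(1/N) Σ_{i<N} f(Y_i) → π̃ f` (`markovChain_slln`). -/
theorem jumpChain_slln (hw : Measurable w) (hw0 : ∀ x, 0 < w x)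
    [IsProbabilityMeasure π] (hπ : (q.withDensity fun x => ENNReal.ofReal (w x)) = π)
    {f : Ω → ℝ} (hf : Measurable f) {C : ℝ} (hC : ∀ x, |f x| ≤ C) :
    ∀ᵐ x ∂(Kernel.trajMeasure (X := fun _ : ℕ => Ω) μ₀
          (fun m : ℕ => (imhJump q w).comap
            (fun y : (i : ↥(Finset.Iic m)) → Ω => y ⟨m, Finset.mem_Iic.2 le_rfl⟩)
            (measurable_pi_apply _))),
      Tendsto (fun N : ℕ => (∑ i ∈ Finset.range N, f (x i)) / N) atTop
        (𝓝 (∫ z, f z ∂(imhTilt q w π))) := by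
  haveI := isProbabilityMeasure_imhTilt (q := q) (π := π) hw hw0
  have hne0 := lintegral_imhAcceptMass_ne_zero (q := q) (π := π) hw hw0
  have hlt : (∫⁻ x, imhAcceptMass q w x ∂π) / 2 < 1 :=
    (ENNReal.half_lt_self hne0 (ne_top_of_le_ne_top ENNReal.one_ne_top
      (lintegral_imhAcceptMass_le_one π))).trans_le (lintegral_imhAcceptMass_le_one π)
  exact markovChain_slln (κ := imhJump q w) (ν := imhTilt q w π) (imhJump_invariant hw hw0 hπ)
    (fun x B hB => JumpReweight.doeblin_of_le hw hw0 hπ ENNReal.half_le_self x hB)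
    (ENNReal.half_pos hne0) hlt hf hC μ₀

/-- **THE PROPOSAL CLOCK** (floor `α ≥ m > 0`): `P̃_{μ₀}`-a.s. `D_N = (1/N) Σ 1/α(Y_i) → 1/ā`. -/
theorem meanInvAccept_tendsto_ae (hw : Measurable w) (hw0 : ∀ x, 0 < w x)
    [IsProbabilityMeasure π] (hπ : (q.withDensity fun x => ENNReal.ofReal (w x)) = π)
    {m : ℝ} (hm0 : 0 < m) (hm : ∀ x, ENNReal.ofReal m ≤ imhAcceptMass q w x) :
    ∀ᵐ x ∂(Kernel.trajMeasure (X := fun _ : ℕ => Ω) μ₀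
          (fun m : ℕ => (imhJump q w).comap
            (fun y : (i : ↥(Finset.Iic m)) → Ω => y ⟨m, Finset.mem_Iic.2 le_rfl⟩)
            (measurable_pi_apply _))),
      Tendsto (fun N : ℕ => (∑ i ∈ Finset.range N, 1 / (imhAcceptMass q w (x i)).toReal) / N)
        atTop (𝓝 ((∫⁻ x, imhAcceptMass q w x ∂π).toReal)⁻¹) := by
  have h1m : Measurable fun z : Ω => 1 / (imhAcceptMass q w z).toReal :=
    measurable_const.div (measurable_toReal_imhAcceptMass hw)
  have h1b : ∀ z, |1 / (imhAcceptMass q w z).toReal| ≤ 1 / m := fun z => by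
    rw [abs_of_pos (one_div_pos.2 (toReal_imhAcceptMass_pos hw hw0 z))]
    exact one_div_le_one_div_of_le hm0 (JumpVar.le_toReal_acceptMass hm z)
  have h := jumpChain_slln (μ₀ := μ₀) hw hw0 hπ h1m h1b
  rwa [JumpRatio.integral_tilt_inv hw hw0] at h

/-- **STRONG CONSISTENCY OF THE SOJOURN-REWEIGHTED ESTIMATOR, ANY START** (floor `α ≥ m > 0`,
`|g| ≤ C` measurable): `P̃_{μ₀}`-a.s. `R_N = Σ_{i<N} g(Y_i)/α(Y_i) / Σ_{i<N} 1/α(Y_i) → πg`. -/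
theorem reweighted_tendsto_ae (hw : Measurable w) (hw0 : ∀ x, 0 < w x)
    [IsProbabilityMeasure π] (hπ : (q.withDensity fun x => ENNReal.ofReal (w x)) = π)
    {m : ℝ} (hm0 : 0 < m) (hm : ∀ x, ENNReal.ofReal m ≤ imhAcceptMass q w x)
    {g : Ω → ℝ} (hg : Measurable g) {C : ℝ} (hC : ∀ x, |g x| ≤ C) :
    ∀ᵐ x ∂(Kernel.trajMeasure (X := fun _ : ℕ => Ω) μ₀
          (fun m : ℕ => (imhJump q w).comap
            (fun y : (i : ↥(Finset.Iic m)) → Ω => y ⟨m, Finset.mem_Iic.2 le_rfl⟩)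
            (measurable_pi_apply _))),
      Tendsto (fun N : ℕ => (∑ i ∈ Finset.range N, g (x i) / (imhAcceptMass q w (x i)).toReal)
          / (∑ i ∈ Finset.range N, 1 / (imhAcceptMass q w (x i)).toReal))
        atTop (𝓝 (∫ z, g z ∂π)) := by
  set u : Ω → ℝ := fun z => (g z - ∫ y, g y ∂π) / (imhAcceptMass q w z).toReal with hu
  have hum : Measurable u := JumpVar.measurable_div hw (hg.sub measurable_const)
  have hub : ∀ z, |u z| ≤ (C + |∫ y, g y ∂π|) / m :=
    JumpReweight.abs_centredDiv_le hw hw0 hm0 hm hC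
  have hu0 : ∫ z, u z ∂(imhTilt q w π) = 0 :=
    JumpReweight.integral_tilt_centredDiv hw hw0 (integrable_of_bounded π hg hC)
  filter_upwards [jumpChain_slln (μ₀ := μ₀) hw hw0 hπ hum hub] with x hx
  rw [hu0] at hx
  have h0 : Tendsto (fun N : ℕ => |(∑ i ∈ Finset.range N, u (x i)) / N|) atTop (𝓝 0) := by
    simpa using hx.abs
  refine tendsto_sub_nhds_zero_iff.1 (squeeze_zero_norm' ?_ h0)
  filter_upwards [eventually_ne_atTop 0] with N hN
  rw [Real.norm_eq_abs]
  exact JumpReweight.abs_reweighted_sub_le hw hw0 g _ hN x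

/-! ### §3 The variance in closed form, the Rao–Blackwell gain, and the ratio CLT -/

omit [IsMarkovKernel (imhJump q w)] in
/-- **THE VARIANCE IN CLOSED FORM** (floor `α ≥ m > 0`, `|g| ≤ C` measurable, `ḡ = g − πg`):
`ā² σ²_J̃(ḡ/α) = ā (σ²_K(ḡ) − (∫ ḡ²/α dπ − ∫ ḡ² dπ))` (VIII's shared Poisson solution: both
Green–Kubo sums are `∫ ḡ h dπ`, over `ā` on the accepted rows). -/
theorem reweighted_asympVar_eq (hw : Measurable w) (hw0 : ∀ x, 0 < w x)
    [IsProbabilityMeasure π] (hπ : (q.withDensity fun x => ENNReal.ofReal (w x)) = π)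
    {m : ℝ} (hm0 : 0 < m) (hm : ∀ x, ENNReal.ofReal m ≤ imhAcceptMass q w x)
    {g : Ω → ℝ} (hg : Measurable g) {C : ℝ} (hC : ∀ x, |g x| ≤ C) :
    (∫⁻ x, imhAcceptMass q w x ∂π).toReal ^ 2
        * ((∫ y, ((g y - ∫ z, g z ∂π) / (imhAcceptMass q w y).toReal) ^ 2 ∂(imhTilt q w π))
          + 2 * ∑' k, ∫ y, (g y - ∫ z, g z ∂π) / (imhAcceptMass q w y).toReal
              * (kop (imhJump q w))^[k + 1]
                  (fun y => (g y - ∫ z, g z ∂π) / (imhAcceptMass q w y).toReal) y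
                ∂(imhTilt q w π))
      = (∫⁻ x, imhAcceptMass q w x ∂π).toReal
        * (((∫ y, (g y - ∫ z, g z ∂π) ^ 2 ∂π)
              + 2 * ∑' k, ∫ y, (g y - ∫ z, g z ∂π)
                  * (kop (indepMH q w))^[k + 1] (fun y => g y - ∫ z, g z ∂π) y ∂π)
            - (∫ y, (g y - ∫ z, g z ∂π) ^ 2 / (imhAcceptMass q w y).toReal ∂π
                - ∫ y, (g y - ∫ z, g z ∂π) ^ 2 ∂π)) := by
  have hā : (∫⁻ x, imhAcceptMass q w x ∂π).toReal ≠ 0 := (JumpVar.toReal_abar_pos hw hw0).ne'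
  have hgm : Measurable fun y => g y - ∫ z, g z ∂π := hg.sub measurable_const
  have hgC : ∀ y, |g y - ∫ z, g z ∂π| ≤ C + |∫ z, g z ∂π| := fun y =>
    (abs_sub _ _).trans (add_le_add (hC y) le_rfl)
  have hg0 : ∫ y, (g y - ∫ z, g z ∂π) ∂π = 0 := by
    rw [integral_sub (integrable_of_bounded π hg hC) (integrable_const _), integral_const,
      probReal_univ, one_smul, sub_self]
  obtain ⟨h, hh, hCh, hpoisJ, -⟩ := exists_shared_poisson hw hw0 hπ hm0 hm hgm hgC hg0
  obtain ⟨hK, hJ⟩ := hasSum_autocov_of_shared_poisson hw hw0 hπ hm0 hm hgm hgC hg0 hh hCh hpoisJ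
  have hK1 := ((hasSum_nat_add_iff' 1).2 hK).tsum_eq
  have hJ1 := ((hasSum_nat_add_iff' 1).2 hJ).tsum_eq
  rw [Finset.sum_range_one, autocov_zero] at hK1 hJ1
  simp only [autocov] at hK1 hJ1
  rw [hK1, hJ1, JumpVar.integral_tilt_div_sq hw hw0 π fun y => g y - ∫ z, g z ∂π]
  field_simp
  ring

omit [IsMarkovKernel (imhJump q w)] in
/-- **THE RAO–BLACKWELL GAIN** `V ≤ ā σ²_K(ḡ)`: per proposal (`N` acceptances `∼ N/ā` of them)
the reweighted constant `V/ā = σ²_K(ḡ) − ∫ ḡ²(1/α − 1) dπ` never exceeds the plain `σ²_K(ḡ)`. -/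
theorem reweighted_asympVar_le (hw : Measurable w) (hw0 : ∀ x, 0 < w x) [IsProbabilityMeasure π]
    {m : ℝ} (hm0 : 0 < m) (hm : ∀ x, ENNReal.ofReal m ≤ imhAcceptMass q w x)
    {g : Ω → ℝ} (hg : Measurable g) {C : ℝ} (hC : ∀ x, |g x| ≤ C) :
    (∫⁻ x, imhAcceptMass q w x ∂π).toReal
        * (((∫ y, (g y - ∫ z, g z ∂π) ^ 2 ∂π)
              + 2 * ∑' k, ∫ y, (g y - ∫ z, g z ∂π)
                  * (kop (indepMH q w))^[k + 1] (fun y => g y - ∫ z, g z ∂π) y ∂π)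
            - (∫ y, (g y - ∫ z, g z ∂π) ^ 2 / (imhAcceptMass q w y).toReal ∂π
                - ∫ y, (g y - ∫ z, g z ∂π) ^ 2 ∂π))
      ≤ (∫⁻ x, imhAcceptMass q w x ∂π).toReal
        * ((∫ y, (g y - ∫ z, g z ∂π) ^ 2 ∂π)
              + 2 * ∑' k, ∫ y, (g y - ∫ z, g z ∂π)
                  * (kop (indepMH q w))^[k + 1] (fun y => g y - ∫ z, g z ∂π) y ∂π) :=
  mul_le_mul_of_nonneg_left (sub_le_self _ (sub_nonneg.2
    (JumpVar.integral_sq_le_div hw hw0 hm0 hm (hg.sub measurable_const) (C := C + |∫ z, g z ∂π|)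
      fun y => (abs_sub _ _).trans (add_le_add (hC y) le_rfl)).2)) ENNReal.toReal_nonneg

/-- **THE RATIO CLT FOR THE SOJOURN-REWEIGHTED ESTIMATOR, ANY START** (`π = w q` a probability
law, floor `α ≥ m > 0`, `|g| ≤ C` measurable, `ḡ = g − πg`): for `Y` with law
`N(0, ā (σ²_K(ḡ) − (∫ ḡ²/α dπ − ∫ ḡ² dπ)))`, `√N (R_N − πg) ⇒ Y` under `P̃_{μ₀}`. -/
theorem reweighted_clt (hw : Measurable w) (hw0 : ∀ x, 0 < w x)
    [IsProbabilityMeasure π] (hπ : (q.withDensity fun x => ENNReal.ofReal (w x)) = π)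
    {m : ℝ} (hm0 : 0 < m) (hm : ∀ x, ENNReal.ofReal m ≤ imhAcceptMass q w x)
    {g : Ω → ℝ} (hg : Measurable g) {C : ℝ} (hC : ∀ x, |g x| ≤ C)
    {Ω' : Type*} [MeasurableSpace Ω'] {P' : Measure Ω'} [IsProbabilityMeasure P'] {Y : Ω' → ℝ}
    (hY : HasLaw Y (gaussianReal 0 (Real.toNNReal ((∫⁻ x, imhAcceptMass q w x ∂π).toReal
        * (((∫ y, (g y - ∫ z, g z ∂π) ^ 2 ∂π)
              + 2 * ∑' k, ∫ y, (g y - ∫ z, g z ∂π)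
                  * (kop (indepMH q w))^[k + 1] (fun y => g y - ∫ z, g z ∂π) y ∂π)
            - (∫ y, (g y - ∫ z, g z ∂π) ^ 2 / (imhAcceptMass q w y).toReal ∂π
                - ∫ y, (g y - ∫ z, g z ∂π) ^ 2 ∂π))))) P')
    [IsProbabilityMeasure (Kernel.trajMeasure (X := fun _ : ℕ => Ω) μ₀
          (fun m : ℕ => (imhJump q w).comap
            (fun y : (i : ↥(Finset.Iic m)) → Ω => y ⟨m, Finset.mem_Iic.2 le_rfl⟩)
            (measurable_pi_apply _)))] :
    TendstoInDistribution (fun (N : ℕ) (x : ℕ → Ω) =>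
        Real.sqrt N * ((∑ i ∈ Finset.range N, g (x i) / (imhAcceptMass q w (x i)).toReal)
            / (∑ i ∈ Finset.range N, 1 / (imhAcceptMass q w (x i)).toReal) - ∫ z, g z ∂π))
      atTop Y (fun _ => Kernel.trajMeasure (X := fun _ : ℕ => Ω) μ₀
          (fun m : ℕ => (imhJump q w).comap
            (fun y : (i : ↥(Finset.Iic m)) → Ω => y ⟨m, Finset.mem_Iic.2 le_rfl⟩)
            (measurable_pi_apply _))) P' := by
  haveI := isProbabilityMeasure_imhTilt (q := q) (π := π) hw hw0
  rw [← reweighted_asympVar_eq hw hw0 hπ hm0 hm hg hC] at hY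
  set σJ := (∫ y, ((g y - ∫ z, g z ∂π) / (imhAcceptMass q w y).toReal) ^ 2 ∂(imhTilt q w π))
        + 2 * ∑' k, ∫ y, (g y - ∫ z, g z ∂π) / (imhAcceptMass q w y).toReal
            * (kop (imhJump q w))^[k + 1]
                (fun y => (g y - ∫ z, g z ∂π) / (imhAcceptMass q w y).toReal) y
              ∂(imhTilt q w π) with hσJ
  set ā := (∫⁻ x, imhAcceptMass q w x ∂π).toReal with hā
  have hā0 : 0 < ā := JumpVar.toReal_abar_pos hw hw0
  have hā1 : ā ≤ 1 := by
    simpa using ENNReal.toReal_mono ENNReal.one_ne_top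
      (lintegral_imhAcceptMass_le_one (q := q) (w := w) π)
  set u : Ω → ℝ := fun z => (g z - ∫ y, g y ∂π) / (imhAcceptMass q w z).toReal with hu
  have hum : Measurable u := JumpVar.measurable_div hw (hg.sub measurable_const)
  have hub : ∀ z, |u z| ≤ (C + |∫ y, g y ∂π|) / m :=
    JumpReweight.abs_centredDiv_le hw hw0 hm0 hm hC
  have hu0 : ∫ z, u z ∂(imhTilt q w π) = 0 :=
    JumpReweight.integral_tilt_centredDiv hw hw0 (integrable_of_bounded π hg hC)
  set σ2 := (∫ y, (u y - ∫ z, u z ∂(imhTilt q w π)) ^ 2 ∂(imhTilt q w π))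
      + 2 * ∑' k, ∫ y, (u y - ∫ z, u z ∂(imhTilt q w π))
          * (kop (imhJump q w))^[k + 1] (fun y => u y - ∫ z, u z ∂(imhTilt q w π)) y
            ∂(imhTilt q w π) with hσ2
  have hσ : σ2 = σJ := by
    rw [hσ2, hσJ, hu0]; simp only [sub_zero, hu]
  have hne0 := lintegral_imhAcceptMass_ne_zero (q := q) (π := π) hw hw0
  have hlt : (∫⁻ x, imhAcceptMass q w x ∂π) / 2 < 1 :=
    (ENNReal.half_lt_self hne0 (ne_top_of_le_ne_top ENNReal.one_ne_top
      (lintegral_imhAcceptMass_le_one π))).trans_le (lintegral_imhAcceptMass_le_one π)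
  have hσ0 : 0 ≤ σ2 := asymptoticVariance_nonneg_minorised (κ := imhJump q w)
    (ν := imhTilt q w π) (imhJump_invariant hw hw0 hπ)
    (fun x B hB => JumpReweight.doeblin_of_le hw hw0 hπ ENNReal.half_le_self x hB)
    (ENNReal.half_pos hne0) hlt hum hub
  have hZ : HasLaw (fun ω => ā⁻¹ * Y ω) (gaussianReal 0 (Real.toNNReal σ2)) P' := by
    refine ⟨hY.aemeasurable.const_mul _, ?_⟩
    rw [show (fun ω => ā⁻¹ * Y ω) = (fun a : ℝ => ā⁻¹ * a) ∘ Y from rfl,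
      ← AEMeasurable.map_map_of_aemeasurable (measurable_const_mul _).aemeasurable hY.aemeasurable,
      hY.map_eq, gaussianReal_map_const_mul, mul_zero]
    congr 1
    apply NNReal.coe_injective
    rw [NNReal.coe_mul, NNReal.coe_mk, Real.coe_toNNReal _ hσ0,
      Real.coe_toNNReal _ (mul_nonneg (sq_nonneg _) (hσ ▸ hσ0)), hσ]
    field_simp
  have hclt := jumpChain_clt (μ₀ := μ₀) hw hw0 hπ hum hub hZ
  have h1m : Measurable fun z : Ω => 1 / (imhAcceptMass q w z).toReal :=
    measurable_const.div (measurable_toReal_imhAcceptMass hw)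
  have hDm : ∀ N : ℕ, Measurable fun x : ℕ → Ω =>
      (∑ i ∈ Finset.range N, 1 / (imhAcceptMass q w (x i)).toReal) / N := fun N =>
    (Finset.measurable_sum _ fun i _ => h1m.comp (measurable_pi_apply i)).div_const _
  have hD := tendstoInMeasure_of_tendsto_ae (fun N => (hDm N).aestronglyMeasurable)
    (meanInvAccept_tendsto_ae (μ₀ := μ₀) hw hw0 hπ hm0 hm)
  have hgc : Continuous fun p : ℝ × ℝ => p.1 / max p.2 1 :=
    continuous_fst.div (continuous_snd.max continuous_const) fun p =>
      (lt_of_lt_of_le one_pos (le_max_right _ _)).ne'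
  have hS := hclt.continuous_comp_prodMk_of_tendstoInMeasure_const hgc hD
    fun N => (hDm N).aemeasurable
  refine hS.congr (fun N => ae_of_all _ fun x => ?_) (ae_of_all _ fun ω => ?_)
  · simp only [hu0, sub_zero]
    exact (JumpRatio.sqrt_mul_ratio_sub_eq (a := fun i => (imhAcceptMass q w (x i)).toReal)
      (g := fun i => g (x i)) (fun i => toReal_imhAcceptMass_pos hw hw0 (x i))
      (fun i => toReal_imhAcceptMass_le_one (x i)) (∫ z, g z ∂π) N).symm
  · show ā⁻¹ * Y ω / max ā⁻¹ 1 = Y ω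
    rw [max_eq_left ((one_le_inv₀ hā0).2 hā1), mul_div_cancel_left₀ _ (inv_ne_zero hā0.ne')]

end Path

/-! ### §4 The lattice instance -/

section Lattice
open Literature.MathematicalPhysics.QuantumFieldTheory
open Literature.MathematicalPhysics.QuantumFieldTheory.Luscher2010
open Summit.Ventures.LatticeQCDFlow.TrivializingMaps
open scoped Matrix Matrix.Norms.Frobenius ContDiff
variable {d L n : ℕ} [NeZero L]

/-- **THE SOJOURN-REWEIGHTED ESTIMATOR OF AN EXACT FLOW SAMPLER ON `SU(n)^E`: STRONGLY
CONSISTENT AND ASYMPTOTICALLY NORMAL FROM ANY START, every volume** (hypotheses of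
`Exactness.flowSampler_exact_doeblin`: smooth action and flow generator, Lüscher defect `≤ δ`,
`q = (Φ 1)_* D[V]`, `π` = Boltzmann): for EVERY initial law `μ₀` and bounded measurable `g`,
`R_N → πg` a.s. and `√N (R_N − πg) ⇒ N(0, ā (σ²_K(ḡ) − (∫ ḡ²/α dπ − ∫ ḡ² dπ)))`. -/
theorem flowSampler_jump_ratio_clt (B : SuBasis n)
    {S : AmbConfig d L n → ℝ} (hS : ContDiff ℝ ∞ S) {F : ℝ → AmbConfig d L n → ℝ}
    (hF : ContDiff ℝ ∞ fun p : ℝ × AmbConfig d L n => F p.1 p.2)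
    {Φ} (hΦ : IsFlowMap (fun t W => -linkGrad B (F t) W) Φ) {c : ℝ → ℝ} {δ : ℝ}
    (hδ : ∀ t ∈ Set.Icc (0 : ℝ) 1, ∀ U : GaugeConfig d L (Matrix.specialUnitaryGroup (Fin n) ℂ),
      |luscherL B S t (F t) (WilsonFlow.coeConfig U) - S (WilsonFlow.coeConfig U) - c t| ≤ δ)
    (q : Measure (GaugeConfig d L (Matrix.specialUnitaryGroup (Fin n) ℂ))) [IsProbabilityMeasure q]
    (hq : q = Measure.map (Φ 1) (trivialMeasure (Matrix.specialUnitaryGroup (Fin n) ℂ) d L))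
    {π : Measure (GaugeConfig d L (Matrix.specialUnitaryGroup (Fin n) ℂ))} [IsProbabilityMeasure π]
    (hπB : π = boltzmannMeasure fun U => S (WilsonFlow.coeConfig U)) :
    ∃ w : GaugeConfig d L (Matrix.specialUnitaryGroup (Fin n) ℂ) → ℝ, Measurable w ∧
      (∀ U, 0 < w U) ∧ (q.withDensity fun U => ENNReal.ofReal (w U)) = π ∧
      IsMarkovKernel (imhJump q w) ∧
      ∀ [IsMarkovKernel (imhJump q w)]
        (μ₀ : Measure (GaugeConfig d L (Matrix.specialUnitaryGroup (Fin n) ℂ)))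
        [IsProbabilityMeasure μ₀]
        {g : GaugeConfig d L (Matrix.specialUnitaryGroup (Fin n) ℂ) → ℝ}, Measurable g →
        ∀ {C : ℝ}, (∀ U, |g U| ≤ C) →
        (∀ᵐ x ∂(Kernel.trajMeasure
              (X := fun _ : ℕ => GaugeConfig d L (Matrix.specialUnitaryGroup (Fin n) ℂ)) μ₀
              (fun m : ℕ => (imhJump q w).comap
                (fun y : (i : ↥(Finset.Iic m)) →
                    GaugeConfig d L (Matrix.specialUnitaryGroup (Fin n) ℂ) =>
                  y ⟨m, Finset.mem_Iic.2 le_rfl⟩) (measurable_pi_apply _))),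
          Tendsto (fun N : ℕ =>
              (∑ i ∈ Finset.range N, g (x i) / (imhAcceptMass q w (x i)).toReal)
                / (∑ i ∈ Finset.range N, 1 / (imhAcceptMass q w (x i)).toReal))
            atTop (𝓝 (∫ V, g V ∂π))) ∧
        ∀ {Ω' : Type} [MeasurableSpace Ω'] {P' : Measure Ω'} [IsProbabilityMeasure P']
          {Y : Ω' → ℝ}, HasLaw Y (gaussianReal 0 (Real.toNNReal
            ((∫⁻ U, imhAcceptMass q w U ∂π).toReal
              * (((∫ U, (g U - ∫ V, g V ∂π) ^ 2 ∂π)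
                    + 2 * ∑' k, ∫ U, (g U - ∫ V, g V ∂π)
                        * (kop (indepMH q w))^[k + 1] (fun U => g U - ∫ V, g V ∂π) U ∂π)
                  - (∫ U, (g U - ∫ V, g V ∂π) ^ 2 / (imhAcceptMass q w U).toReal ∂π
                      - ∫ U, (g U - ∫ V, g V ∂π) ^ 2 ∂π))))) P' →
          ∀ [IsProbabilityMeasure (Kernel.trajMeasure
              (X := fun _ : ℕ => GaugeConfig d L (Matrix.specialUnitaryGroup (Fin n) ℂ)) μ₀
              (fun m : ℕ => (imhJump q w).comap
                (fun y : (i : ↥(Finset.Iic m)) →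
                    GaugeConfig d L (Matrix.specialUnitaryGroup (Fin n) ℂ) =>
                  y ⟨m, Finset.mem_Iic.2 le_rfl⟩) (measurable_pi_apply _)))],
          TendstoInDistribution
            (fun (N : ℕ) (x : ℕ → GaugeConfig d L (Matrix.specialUnitaryGroup (Fin n) ℂ)) =>
              Real.sqrt N * ((∑ i ∈ Finset.range N, g (x i) / (imhAcceptMass q w (x i)).toReal)
                / (∑ i ∈ Finset.range N, 1 / (imhAcceptMass q w (x i)).toReal) - ∫ V, g V ∂π))
            atTop Y (fun _ => Kernel.trajMeasure
              (X := fun _ : ℕ => GaugeConfig d L (Matrix.specialUnitaryGroup (Fin n) ℂ)) μ₀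
              (fun m : ℕ => (imhJump q w).comap
                (fun y : (i : ↥(Finset.Iic m)) →
                    GaugeConfig d L (Matrix.specialUnitaryGroup (Fin n) ℂ) =>
                  y ⟨m, Finset.mem_Iic.2 le_rfl⟩) (measurable_pi_apply _))) P' := by
  obtain ⟨w, hw, hlo, -, hπ, -, hα, -⟩ := flowSampler_exact_doeblin B hS hF hΦ hδ q hq
  rw [← hπB] at hπ
  have hw0 : ∀ U, 0 < w U := fun U => (Real.exp_pos _).trans_le (hlo U)
  refine ⟨w, hw, hw0, hπ, isMarkovKernel_imhJump hw hw0, ?_⟩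
  intro _ μ₀ _ g hg C hC
  exact ⟨reweighted_tendsto_ae hw hw0 hπ (Real.exp_pos _) hα hg hC,
    fun hY _ => reweighted_clt hw hw0 hπ (Real.exp_pos _) hα hg hC hY⟩

end Lattice

end Summit.Ventures.LatticeQCDFlow.Scoring
end
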